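import Literature.Analysis.FunctionSpaces.SobolevBallScaling
import Mathlib.Analysis.Calculus.ParametricIntegral
import Mathlib.Topology.MetricSpace.Thickening
import HarnessLib

/-!
# Crux `BlockLipschitzL` (stmt-QuantumFields-23533) ∕ `HistoryTailL` (stmt-QuantumFields-19936), LINE 25 «CompactnessTransfer»,
# stub S1″ — ROAD (H) «SU(2) currents ⇒ H-system ⇒ 8π quantum», brick (T) «CONE → PLANE TRANSPORT»,
# FILE B-LETTERS «THE RADIAL WEAK IDENTITY AND THE DILATED PAIRING»

Cell `ym3-torus` (YM ladder rung R3 = continuum SU(2) Yang–Mills on T³ — a RUNG, NOT Clay: not d = 4, not infinite volume,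
not a mass gap); WIDTH helper seat `ym3-torus-px14` g7 (brick (T) of px19 g8's ROAD (H) memo `ROAD-TM-HSYSTEM-px19g8.md`,
architecture v1: the (GAP) socket of px3 g9).  Helper `--supports stmt-QuantumFields-23533`; THEOREMS ONLY (0 `def`, 0 `sorry`,
default heartbeats); imports lit ✓`SobolevBallScaling` (the Sobolev vocabulary `IsTestFunctionOn`∕`HasWeakFDerivOn` and the affine
transport letters), Mathlib (parametric integrals, compact thickenings).

WHAT THIS FILE PROVES (letters for FILE B `PoincareLipschitzConeLinkDilation`: dilation invariance of radially constant Sobolev maps).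
For `U : E → F` with weak gradient `G` on an open `Ω` of a finite-dimensional real inner product space `E` (`n = dim E`):
* §1 bookkeeping: smooth multiples of test functions, `∫_Ω θ • f = ∫ θ • f` for `θ` supported in `Ω`, integrability of `θ • f`;
* §2 ★ `integral_fderiv_self_smul` — THE RADIAL WEAK IDENTITY `∫ Dψ_z(z) • U z dz = −n • ∫ ψ • U − ∫ ψ z • G z (z) dz`
  (the weak-gradient identity tested against `z ↦ ℓ_i(z)·ψ(z)`, `ℓ_i` the coordinates of a basis, summed over `i`), and its form
  `= −n • ∫ ψ • U` under the tangent-map condition `G x (x) = 0` a.e. (★ `integral_fderiv_self_smul_of_radial`);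
* §3 `exists_inv_smul_mem` — room for dilations: a compact `K ⊆ Ω`, `Ω` star-shaped towards `0`, has `s⁻¹ • K ⊆ Ω` for all
  `s > s₀` with some `s₀ < 1`; `isTestFunctionOn_comp_smul` — `z ↦ g(t • z)` is then a test function on `Ω`;
* §4 ★ `hasDerivAt_integral_comp_smul` — the dilated pairing `τ ↦ ∫_Ω g(τ•z) • U z dz` is differentiable with derivative
  `∫_Ω Dg_{τz}(z) • U z dz` (differentiation under the integral sign, dominated on a compact subset of `Ω`).

HONEST SCOPE.  Sobolev calculus; nothing of (GAP)∕(TM), (C), S1″, K1, `MeanDeviationL`, `BlockLipschitzL`, `HistoryTailL` is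
proved here.  YM₃ on T³ is rung R3, not Clay; YM gap NOT proved; no summit statement is proved here.

References: L. C. Evans, Partial Differential Equations, 2nd ed. (2010) [Evans2010] (§5.2.1 weak derivatives);
L. Simon, Theorems on Regularity and Singularity of Energy Minimizing Maps (1996) [Simon1996] (§3.1: tangent maps are
homogeneous of degree zero).
-/

set_option autoImplicit false

noncomputable section

open MeasureTheory Set Function Filter Topology Metric TopologicalSpace Module
open scoped ContDiff

namespace Summit.QuantumFields.YangMills.Theorems.PoincareLipschitzConeLinkDilationLetters

open Literature.Analysis.FunctionSpaces (IsTestFunctionOn HasWeakFDerivOn)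

variable {E : Type*} [NormedAddCommGroup E] [InnerProductSpace ℝ E] [FiniteDimensional ℝ E]
  [MeasurableSpace E] [BorelSpace E]
variable {F : Type*} [NormedAddCommGroup F] [NormedSpace ℝ F]

/-! ## §1 Bookkeeping: smooth multiples of test functions, integrals of compactly supported products -/

omit [FiniteDimensional ℝ E] [MeasurableSpace E] [BorelSpace E] in
/-- A smooth multiple of a test function on `Ω` is a test function on `Ω`. [cite: Evans2010, §5.2.1] -/
theorem isTestFunctionOn_mul {Ω : Opens E} {ψ θ : E → ℝ} (hψ : IsTestFunctionOn Ω ψ) (hθ : ContDiff ℝ ∞ θ) :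
    IsTestFunctionOn Ω (fun z => θ z * ψ z) where
  contDiff := hθ.mul hψ.contDiff
  hasCompactSupport := by
    have : HasCompactSupport (θ * ψ) := hψ.hasCompactSupport.mul_left
    exact this
  tsupport_subset := by
    have : tsupport (θ * ψ) ⊆ tsupport ψ := tsupport_mul_subset_right
    exact this.trans hψ.tsupport_subset

/-- For `θ` supported in `Ω`, the set integral over `Ω` of `θ • f` is the whole-space integral. [folklore] -/
theorem setIntegral_smul_eq_integral {Ω : Opens E} {θ : E → ℝ} (hθ : tsupport θ ⊆ (Ω : Set E)) (f : E → F) :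
    ∫ x in (Ω : Set E), θ x • f x = ∫ x, θ x • f x := by
  refine setIntegral_eq_integral_of_forall_compl_eq_zero fun x hx => ?_
  rw [image_eq_zero_of_notMem_tsupport (fun h => hx (hθ h)), zero_smul]

/-- A continuous compactly supported multiple (support inside `Ω`) of a function locally integrable on `Ω` is integrable.
[folklore] -/
theorem integrable_smul_of_locallyIntegrableOn {Ω : Opens E} {f : E → F}
    (hf : LocallyIntegrableOn f (Ω : Set E) volume) {θ : E → ℝ} (hθ : Continuous θ) (hθs : HasCompactSupport θ)
    (hθΩ : tsupport θ ⊆ (Ω : Set E)) : Integrable (fun x => θ x • f x) volume := by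
  have hK : IntegrableOn (fun x => θ x • f x) (tsupport θ) volume :=
    (hf.integrableOn_compact_subset hθΩ hθs).continuousOn_smul hθ.continuousOn hθs
  refine (integrableOn_univ.1 ?_)
  refine hK.of_forall_sdiff_eq_zero MeasurableSet.univ fun x hx => ?_
  rw [image_eq_zero_of_notMem_tsupport hx.2, zero_smul]

/-! ## §2 The radial weak identity -/

/-- ★ **THE RADIAL WEAK IDENTITY.**  For `U` with weak gradient `G` on `Ω` and a test function `ψ` on `Ω`:
`∫ Dψ_z(z) • U z dz = −n • ∫ ψ z • U z dz − ∫ ψ z • G z (z) dz` (`n = dim E`) — the weak-gradient identity tested against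
`z ↦ ℓ_i(z) ψ(z)` in the direction `b_i` (`b` a basis, `ℓ_i` its coordinates), summed over `i`. [cite: Evans2010, §5.2.1] -/
theorem integral_fderiv_self_smul {Ω : Opens E} {U : E → F} {G : E → E →L[ℝ] F}
    (hU : HasWeakFDerivOn Ω volume U G) {ψ : E → ℝ} (hψ : IsTestFunctionOn Ω ψ) :
    ∫ z, (fderiv ℝ ψ z z) • U z =
      -((finrank ℝ E : ℝ) • ∫ z, ψ z • U z) - ∫ z, ψ z • G z z := by
  classical
  set b := Module.finBasis ℝ E with hb
  -- the coordinate functionals as smooth functions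
  set ℓ : Fin (finrank ℝ E) → E →L[ℝ] ℝ := fun i => LinearMap.toContinuousLinearMap (b.coord i) with hℓ
  have hℓb : ∀ i j, ℓ i (b j) = if j = i then 1 else 0 := fun i j => by
    simp only [hℓ, LinearMap.coe_toContinuousLinearMap', Basis.coord_apply, Basis.repr_self,
      Finsupp.single_apply]
  have hsum : ∀ z : E, ∑ i, ℓ i z • b i = z := fun z => by
    simp only [hℓ, LinearMap.coe_toContinuousLinearMap', Basis.coord_apply]
    exact b.sum_repr z
  -- the test functions `θ_i z := ℓ_i z * ψ z`
  have hθ : ∀ i, IsTestFunctionOn Ω (fun z => ℓ i z * ψ z) := fun i => isTestFunctionOn_mul hψ (ℓ i).contDiff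
  have hψd : Differentiable ℝ ψ := hψ.contDiff.differentiable (by simp)
  have hDθ : ∀ i z, fderiv ℝ (fun z => ℓ i z * ψ z) z (b i) = ψ z + ℓ i z * fderiv ℝ ψ z (b i) := by
    intro i z
    rw [fderiv_fun_mul ((ℓ i).differentiableAt) (hψd z), ContinuousLinearMap.fderiv]
    simp only [add_apply, FunLike.coe_smul, Pi.smul_apply, smul_eq_mul, hℓb, if_true]
    ring
  -- the weak identity for each `i`, as whole-space integrals
  have hweak : ∀ i, ∫ z, (ψ z + ℓ i z * fderiv ℝ ψ z (b i)) • U z = -∫ z, (ℓ i z * ψ z) • G z (b i) := by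
    intro i
    have h := hU.integral_fderiv_smul_eq _ (b i) (hθ i)
    have hs1 : tsupport (fun z => fderiv ℝ (fun z => ℓ i z * ψ z) z (b i)) ⊆ (Ω : Set E) :=
      (tsupport_fderiv_apply_subset ℝ (b i)).trans (hθ i).tsupport_subset
    rw [setIntegral_smul_eq_integral hs1, setIntegral_smul_eq_integral (hθ i).tsupport_subset] at h
    simpa only [hDθ] using h
  -- integrability of the pieces
  have hψc : Continuous ψ := hψ.contDiff.continuous
  have hI1 : Integrable (fun z => ψ z • U z) volume :=
    integrable_smul_of_locallyIntegrableOn hU.locallyIntegrableOn hψc hψ.hasCompactSupport hψ.tsupport_subset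
  have hI2 : ∀ i, Integrable (fun z => (ℓ i z * fderiv ℝ ψ z (b i)) • U z) volume := by
    intro i
    have hc : Continuous fun z => ℓ i z * fderiv ℝ ψ z (b i) :=
      (ℓ i).continuous.mul ((hψ.contDiff.continuous_fderiv (by simp)).clm_apply continuous_const)
    have hcs : HasCompactSupport fun z => ℓ i z * fderiv ℝ ψ z (b i) := by
      have h := (hψ.hasCompactSupport.fderiv_apply (𝕜 := ℝ) (b i)).mul_left (f := fun z => ℓ i z)
      exact h
    have hts : tsupport (fun z => ℓ i z * fderiv ℝ ψ z (b i)) ⊆ (Ω : Set E) := by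
      have h1 : tsupport ((fun z => ℓ i z) * fun z => fderiv ℝ ψ z (b i)) ⊆ tsupport fun z => fderiv ℝ ψ z (b i) :=
        tsupport_mul_subset_right
      exact (h1.trans (tsupport_fderiv_apply_subset ℝ (b i))).trans hψ.tsupport_subset
    exact integrable_smul_of_locallyIntegrableOn hU.locallyIntegrableOn hc hcs hts
  have hI3 : ∀ i, Integrable (fun z => (ℓ i z * ψ z) • G z (b i)) volume := by
    intro i
    have hc : Continuous fun z => ℓ i z * ψ z := (ℓ i).continuous.mul hψc
    have hGi : LocallyIntegrableOn (fun z => G z (b i)) (Ω : Set E) volume :=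
      (ContinuousLinearMap.apply ℝ F (b i)).locallyIntegrableOn_comp hU.locallyIntegrableOn_deriv
    exact integrable_smul_of_locallyIntegrableOn hGi hc (hθ i).hasCompactSupport (hθ i).tsupport_subset
  -- sum the identities over `i`
  have hweak' : ∀ i, ∫ z, (ℓ i z * fderiv ℝ ψ z (b i)) • U z =
      -(∫ z, ψ z • U z) - ∫ z, (ℓ i z * ψ z) • G z (b i) := by
    intro i
    have h := hweak i
    simp_rw [add_smul] at h
    rw [integral_add hI1 (hI2 i)] at h
    linear_combination (norm := skip) h
    abel
  have hL : ∀ z, (fderiv ℝ ψ z z) • U z = ∑ i, (ℓ i z * fderiv ℝ ψ z (b i)) • U z := by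
    intro z
    have h1 : fderiv ℝ ψ z z = ∑ i, ℓ i z * fderiv ℝ ψ z (b i) := by
      have h := congrArg (fderiv ℝ ψ z) (hsum z).symm
      rw [map_sum] at h
      simpa only [map_smul, smul_eq_mul] using h
    rw [h1, Finset.sum_smul]
  have hR : ∀ z, ψ z • G z z = ∑ i, (ℓ i z * ψ z) • G z (b i) := by
    intro z
    have h := congrArg (G z) (hsum z).symm
    rw [map_sum] at h
    rw [h, Finset.smul_sum]
    refine Finset.sum_congr rfl fun i _ => ?_
    rw [map_smul, smul_smul, mul_comm]
  simp_rw [hL, hR]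
  rw [integral_finsetSum _ (fun i _ => hI2 i), integral_finsetSum _ (fun i _ => hI3 i)]
  simp_rw [hweak']
  rw [Finset.sum_sub_distrib, Finset.sum_neg_distrib, Finset.sum_const, Finset.card_univ, Fintype.card_fin,
    ← Nat.cast_smul_eq_nsmul ℝ]

/-- The radial weak identity under the tangent-map condition `G x (x) = 0` a.e. on `Ω`:
`∫ Dψ_z(z) • U z dz = −n • ∫ ψ z • U z dz`. [cite: Simon1996, §3.1] -/
theorem integral_fderiv_self_smul_of_radial {Ω : Opens E} {U : E → F} {G : E → E →L[ℝ] F}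
    (hU : HasWeakFDerivOn Ω volume U G) (hrad : ∀ᵐ x ∂(volume.restrict (Ω : Set E)), G x x = 0)
    {ψ : E → ℝ} (hψ : IsTestFunctionOn Ω ψ) :
    ∫ z, (fderiv ℝ ψ z z) • U z = -((finrank ℝ E : ℝ) • ∫ z, ψ z • U z) := by
  rw [integral_fderiv_self_smul hU hψ]
  have h0 : ∫ z, ψ z • G z z = 0 := by
    rw [← setIntegral_smul_eq_integral hψ.tsupport_subset]
    refine integral_eq_zero_of_ae ?_
    filter_upwards [hrad] with z hz
    simp only [hz, smul_zero, Pi.zero_apply]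
  rw [h0, sub_zero]


/-! ## §3 Supports under dilation -/

omit [FiniteDimensional ℝ E] [MeasurableSpace E] [BorelSpace E] in
/-- **Room for dilations.**  For a compact `K` inside the open set `Ω` star-shaped towards `0` there is `s₀ ∈ (0,1)` with
`s⁻¹ • K ⊆ Ω` for every `s > s₀`. [folklore] -/
theorem exists_inv_smul_mem {Ω : Opens E} (hstar : ∀ x ∈ (Ω : Set E), ∀ s : ℝ, 1 ≤ s → s⁻¹ • x ∈ (Ω : Set E))
    {K : Set E} (hK : IsCompact K) (hKΩ : K ⊆ (Ω : Set E)) :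
    ∃ s₀ : ℝ, 0 < s₀ ∧ s₀ < 1 ∧ ∀ s : ℝ, s₀ < s → ∀ x ∈ K, s⁻¹ • x ∈ (Ω : Set E) := by
  obtain ⟨δ, hδ, hδK⟩ := hK.exists_cthickening_subset_open Ω.isOpen hKΩ
  obtain ⟨R, hR0, hR⟩ := hK.isBounded.subset_closedBall_lt 0 (0 : E)
  refine ⟨R / (R + δ), by positivity, (div_lt_one (by positivity)).2 (by linarith), fun s hs x hx => ?_⟩
  by_cases h1 : 1 ≤ s
  · exact hstar x (hKΩ hx) s h1
  push Not at h1
  have hs0 : 0 < s := lt_trans (by positivity) hs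
  have hxR : ‖x‖ ≤ R := by simpa [dist_zero_right] using hR hx
  refine hδK (mem_cthickening_of_dist_le _ x δ K hx ?_)
  rw [dist_eq_norm, show s⁻¹ • x - x = (s⁻¹ - 1) • x by rw [sub_smul, one_smul], norm_smul,
    Real.norm_eq_abs, abs_of_nonneg (by rw [sub_nonneg]; exact (one_le_inv₀ hs0).2 h1.le)]
  -- `(s⁻¹ - 1) R ≤ δ` because `s > R/(R+δ)`
  have h2 : R < s * (R + δ) := by rwa [div_lt_iff₀ (by positivity)] at hs
  have h3 : s⁻¹ * R < R + δ := by
    calc s⁻¹ * R < s⁻¹ * (s * (R + δ)) := mul_lt_mul_of_pos_left h2 (inv_pos.2 hs0)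
      _ = R + δ := by rw [← mul_assoc, inv_mul_cancel₀ hs0.ne', one_mul]
  nlinarith [mul_le_mul_of_nonneg_left hxR (sub_nonneg.2 ((one_le_inv₀ hs0).2 h1.le))]

omit [FiniteDimensional ℝ E] [MeasurableSpace E] [BorelSpace E] in
/-- The pull-back `z ↦ g (t • z)` of a test function on `Ω` is a test function on `Ω` once `t⁻¹ • tsupport g ⊆ Ω`
(`t ≠ 0`). [cite: Evans2010, §5.2.1] -/
theorem isTestFunctionOn_comp_smul {Ω : Opens E} {g : E → ℝ} (hg : IsTestFunctionOn Ω g) {t : ℝ} (ht : t ≠ 0)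
    (hK : ∀ x ∈ tsupport g, t⁻¹ • x ∈ (Ω : Set E)) : IsTestFunctionOn Ω (fun z => g (t • z)) := by
  have hpre : tsupport (fun z => g (t • z)) ⊆ (fun z : E => t • z) ⁻¹' tsupport g := by
    refine closure_minimal (fun z hz => subset_closure hz) ((isClosed_tsupport g).preimage (continuous_const_smul t))
  refine ⟨hg.contDiff.comp (contDiff_const_smul t), ?_, fun z hz => ?_⟩
  · exact hg.hasCompactSupport.comp_homeomorph (Homeomorph.smulOfNeZero t ht)
  · have h := hK (t • z) (hpre hz)
    rwa [smul_smul, inv_mul_cancel₀ ht, one_smul] at h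

/-! ## §4 The dilated pairing `t ↦ ∫ g(t•z) • U z dz` -/

/-- **Derivative of the dilated pairing.**  For `U` locally integrable on `Ω`, a test function `g` on `Ω` and `t` with
`[a,b] ∋ t` (`0 < a`) such that `τ⁻¹ • tsupport g ⊆ Ω` for `τ ≥ a`: `τ ↦ ∫_Ω g(τ•z) • U z dz` has derivative
`∫_Ω Dg_{tz}(z) • U z dz` at `t` (differentiation under the integral sign). [folklore] -/
theorem hasDerivAt_integral_comp_smul {Ω : Opens E} {U : E → F} (hU : LocallyIntegrableOn U (Ω : Set E) volume)
    {g : E → ℝ} (hg : IsTestFunctionOn Ω g) {a b t : ℝ} (ha : 0 < a) (hat : a < t) (htb : t < b)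
    (hK : ∀ τ : ℝ, a ≤ τ → ∀ x ∈ tsupport g, τ⁻¹ • x ∈ (Ω : Set E)) :
    HasDerivAt (fun τ : ℝ => ∫ z in (Ω : Set E), g (τ • z) • U z)
      (∫ z in (Ω : Set E), (fderiv ℝ g (t • z) z) • U z) t := by
  have hgc : Continuous g := hg.contDiff.continuous
  have hgd : Differentiable ℝ g := hg.contDiff.differentiable (by simp)
  have hDgc : Continuous (fderiv ℝ g) := hg.contDiff.continuous_fderiv (by simp)
  set K := tsupport g with hKdef
  have hKc : IsCompact K := hg.hasCompactSupport
  obtain ⟨R, hR0, hR⟩ := hKc.isBounded.subset_closedBall_lt 0 (0 : E)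
  obtain ⟨M, hM⟩ := (hg.hasCompactSupport.fderiv (𝕜 := ℝ)).exists_bound_of_continuous hDgc
  have hM0 : 0 ≤ M := (norm_nonneg _).trans (hM 0)
  -- the compact set swept by the supports, inside `Ω`
  set K' : Set E := (fun p : ℝ × E => p.1⁻¹ • p.2) '' (Icc a b ×ˢ K) with hK'def
  have hK'c : IsCompact K' := by
    refine (isCompact_Icc.prod hKc).image_of_continuousOn ?_
    refine ContinuousOn.smul (continuousOn_fst.inv₀ fun p hp => ?_) continuousOn_snd
    exact (lt_of_lt_of_le ha (mem_Icc.1 (mem_prod.1 hp).1).1).ne'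
  have hK'Ω : K' ⊆ (Ω : Set E) := by
    rintro _ ⟨⟨τ, x⟩, hp, rfl⟩
    obtain ⟨hτ, hx⟩ := mem_prod.1 hp
    exact hK τ (mem_Icc.1 hτ).1 x hx
  have hUK' : IntegrableOn U K' volume := hU.integrableOn_compact_subset hK'Ω hK'c
  -- measurability of the integrands
  have hUm : AEStronglyMeasurable U (volume.restrict (Ω : Set E)) := hU.aestronglyMeasurable
  have hFm : ∀ τ : ℝ, AEStronglyMeasurable (fun z => g (τ • z) • U z) (volume.restrict (Ω : Set E)) := fun τ =>
    ((hgc.comp (continuous_const_smul τ)).aestronglyMeasurable).smul hUm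
  have hF'm : ∀ τ : ℝ, AEStronglyMeasurable (fun z => (fderiv ℝ g (τ • z) z) • U z) (volume.restrict (Ω : Set E)) :=
    fun τ => (((hDgc.comp (continuous_const_smul τ)).clm_apply continuous_id).aestronglyMeasurable).smul hUm
  -- integrability at `t`
  have hta : t⁻¹ ≤ a⁻¹ := (inv_le_inv₀ (ha.trans hat) ha).2 hat.le
  have hFint : Integrable (fun z => g (t • z) • U z) (volume.restrict (Ω : Set E)) := by
    have htest := isTestFunctionOn_comp_smul hg (ha.trans hat).ne' (hK t hat.le)
    exact (integrable_smul_of_locallyIntegrableOn hU htest.contDiff.continuous htest.hasCompactSupport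
      htest.tsupport_subset).integrableOn
  -- the dominating function
  have hbound : ∀ᵐ z ∂(volume.restrict (Ω : Set E)), ∀ τ ∈ Ioo a b,
      ‖(fderiv ℝ g (τ • z) z) • U z‖ ≤ K'.indicator (fun z => (M * (a⁻¹ * R)) * ‖U z‖) z := by
    filter_upwards with z τ hτ
    by_cases hz : fderiv ℝ g (τ • z) = 0
    · rw [hz, zero_apply, zero_smul, norm_zero]
      exact Set.indicator_nonneg (fun _ _ => by positivity) _
    have hτK : τ • z ∈ K := tsupport_fderiv_subset ℝ (subset_tsupport _ hz)
    have hτ0 : 0 < τ := ha.trans hτ.1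
    have hzK' : z ∈ K' := ⟨(τ, τ • z), mem_prod.2 ⟨Ioo_subset_Icc_self hτ, hτK⟩, by
      simp [smul_smul, inv_mul_cancel₀ hτ0.ne']⟩
    rw [Set.indicator_of_mem hzK', norm_smul]
    have h1 : ‖fderiv ℝ g (τ • z) z‖ ≤ M * ‖z‖ := (fderiv ℝ g (τ • z)).le_of_opNorm_le (hM _) z
    have h2 : ‖z‖ ≤ a⁻¹ * R := by
      have h3 : ‖τ • z‖ ≤ R := by simpa [dist_zero_right] using hR hτK
      rw [norm_smul, Real.norm_eq_abs, abs_of_pos hτ0] at h3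
      calc ‖z‖ = τ⁻¹ * (τ * ‖z‖) := by rw [← mul_assoc, inv_mul_cancel₀ hτ0.ne', one_mul]
        _ ≤ a⁻¹ * R := mul_le_mul ((inv_le_inv₀ hτ0 ha).2 hτ.1.le) h3 (by positivity) (by positivity)
    calc ‖fderiv ℝ g (τ • z) z‖ * ‖U z‖ ≤ (M * ‖z‖) * ‖U z‖ := by gcongr
      _ ≤ (M * (a⁻¹ * R)) * ‖U z‖ := by gcongr
  have hbint : Integrable (K'.indicator (fun z => (M * (a⁻¹ * R)) * ‖U z‖)) (volume.restrict (Ω : Set E)) := by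
    exact (IntegrableOn.integrable_indicator (hUK'.norm.const_mul (M * (a⁻¹ * R))) hK'c.measurableSet).mono_measure
      Measure.restrict_le_self
  -- pointwise derivative
  have hdiff : ∀ᵐ z ∂(volume.restrict (Ω : Set E)), ∀ τ ∈ Ioo a b,
      HasDerivAt (fun τ : ℝ => g (τ • z) • U z) ((fderiv ℝ g (τ • z) z) • U z) τ := by
    filter_upwards with z τ _
    have h1 : HasDerivAt (fun τ : ℝ => τ • z) z τ := by simpa using (hasDerivAt_id τ).smul_const z
    exact ((hgd (τ • z)).hasFDerivAt.comp_hasDerivAt τ h1).smul_const (U z)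
  exact (hasDerivAt_integral_of_dominated_loc_of_deriv_le (Ioo_mem_nhds hat htb)
    (Filter.Eventually.of_forall hFm) hFint (hF'm t) hbound hbint hdiff).2


omit [FiniteDimensional ℝ E] [MeasurableSpace E] [BorelSpace E] in
/-- `tsupport (z ↦ Df_z(z)) ⊆ tsupport f`. [folklore] -/
theorem tsupport_fderiv_apply_self_subset (f : E → ℝ) :
    tsupport (fun z => fderiv ℝ f z z) ⊆ tsupport f := by
  refine closure_minimal (fun z hz => ?_) (isClosed_tsupport f)
  have h : fderiv ℝ f z ≠ 0 := fun h0 => hz (show fderiv ℝ f z z = 0 by rw [h0]; rfl)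
  exact tsupport_fderiv_subset ℝ (subset_tsupport _ h)

end Summit.QuantumFields.YangMills.Theorems.PoincareLipschitzConeLinkDilationLetters

end
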